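import Mathlib
import Summits.CriticalPhenomena.CardyFormulaZ2.Theorems.CardySelfRefinementGradientComparabilityStubNonAxialShareBulkFrames
import HarnessLib

/-!
# Boundary-layer surgery, brick (S2) free-cell transfer, part I: trimming and entry/exit corners

Helper file of the registered stub `stub_layerLocalModification` (deterministic boundary-layer
surgery) of the line `monotone-product-coordinates` (crux `stmt-CriticalPhenomena-10269`,
`…Theses.CardySelfRefinement.GradientComparability`), case (S2) of the landed dichotomy
`quadCarrier_cell_or_bridge`: a pivotal axial edge `e = {p, q}` with a FREE adjacent closed cell
`p, q, q', p'` inside `[Q]`.  The new crossing of the transfer is the old one cut at its FIRST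
entry into the drawn cell boundary (a corner `c_in`, from `∂₀Q`) and at its LAST exit (a corner
`c_out ≠ c_in`, to `∂₂Q`), re-routed along the cell boundary through the rail `{p', q'}`, all
other lattice edges at the remaining corners being closed.  Configuration-free topology of the
two cuts (closure semantics, path form `exists_isCrossing_iff_joinedIn`):
`exists_first_hit_avoid` / `exists_last_hit_avoid` (hitting times recording avoidance);
`trim_edge` / `trim_list` (**trimming dangling edges**: a preconnected `K` inside the drawing of
`τ` missing the drawn end `δx` of the edge `{x, y}` stays preconnected after removing the open
drawing of `{x, y}` — the two closed pieces are glued at the single point `δy`,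
`isPreconnected_inter_union_patch`); `trimmed_link` (an arc meeting the corner set only at `c`
links its end on `∂₀Q ∪ ∂₂Q` to `δc` inside the drawing of `ρ` minus the cell edges and minus
every lattice edge at another corner: the sixteen (corner, neighbour) pairs are trimmed one by
one); `freeCell_entryExit` (registered helper): the corners `c_in ≠ c_out` with their trimmed
links, `c_in` not linked to `∂₂Q`, `c_out` not to `∂₀Q`, the two not joined, inside the drawing
of `ρ ∖ {e}`.  No percolation, no named fact.
-/

noncomputable section

namespace Summit.CriticalPhenomena.CardyFormulaZ2.Theorems.CardySelfRefinement

open scoped Topology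
open Filter Set MeasureTheory Metric
open Literature.Probability.LatticeModels Literature.Probability.Percolation
open Literature.Probability.Percolation.QuadCrossing
open Summit.CriticalPhenomena.CardyFormulaZ2.Theses.CardySelfRefinement

variable {D : Set ℂ} {δ : ℝ}

/-! ## Hitting times, with avoidance -/

/-- **First hit, with avoidance.**  A continuous arc `γ` on `[lo, hi]` covered by the closed sets
`O ∪ A`, starting off `A` and ending in `A`, first hits `A` at a time `t > lo`; up to `t` it stays
inside `O`, and strictly before `t` it avoids `A`. -/
theorem exists_first_hit_avoid {γ : ℝ → ℂ} (hγ : Continuous γ) {O A : Set ℂ} (hO : IsClosed O)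
    (hA : IsClosed A) {lo hi : ℝ} (hle : lo ≤ hi) (hcov : ∀ u ∈ Icc lo hi, γ u ∈ O ∪ A)
    (hlo : γ lo ∉ A) (hhi : γ hi ∈ A) :
    ∃ t ∈ Ioc lo hi, γ t ∈ A ∧ (∀ u ∈ Icc lo t, γ u ∈ O) ∧ ∀ u ∈ Ico lo t, γ u ∉ A := by
  set T : Set ℝ := Icc lo hi ∩ γ ⁻¹' A with hT
  have hTc : IsClosed T := isClosed_Icc.inter (hA.preimage hγ)
  have hTne : T.Nonempty := ⟨hi, right_mem_Icc.2 hle, hhi⟩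
  have hTbdd : BddBelow T := ⟨lo, fun u hu => hu.1.1⟩
  set t := sInf T with ht
  have htT : t ∈ T := hTc.csInf_mem hTne hTbdd
  have hlt : lo < t := (eq_or_lt_of_le htT.1.1).resolve_left fun h => hlo (h ▸ htT.2 : γ lo ∈ A)
  have havoid : ∀ u ∈ Ico lo t, γ u ∉ A := fun u hu h =>
    absurd (csInf_le hTbdd ⟨⟨hu.1, hu.2.le.trans htT.1.2⟩, h⟩) (not_le.2 hu.2)
  have hbefore : ∀ u ∈ Ico lo t, γ u ∈ O := fun u hu =>
    (hcov u ⟨hu.1, hu.2.le.trans htT.1.2⟩).resolve_right (havoid u hu)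
  have htO : γ t ∈ O := by
    have hmem : t ∈ closure (Ico lo t) := by
      rw [closure_Ico hlt.ne]; exact right_mem_Icc.2 hlt.le
    have himg : γ t ∈ closure (γ '' Ico lo t) := hγ.continuousWithinAt.mem_closure_image hmem
    exact hO.closure_subset_iff.2 (Set.image_subset_iff.2 fun x hx => hbefore x hx) himg
  refine ⟨t, ⟨hlt, htT.1.2⟩, htT.2, fun u hu => ?_, havoid⟩
  rcases eq_or_lt_of_le hu.2 with h | hut
  · rw [h]; exact htO
  · exact hbefore u ⟨hu.1, hut⟩

/-- **Last hit, with avoidance.**  A continuous arc `γ` on `[lo, hi]` covered by the closed sets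
`O ∪ A`, starting in `A` and ending off `A`, last hits `A` at a time `t < hi`; from `t` on it
stays inside `O`, and strictly after `t` it avoids `A`. -/
theorem exists_last_hit_avoid {γ : ℝ → ℂ} (hγ : Continuous γ) {O A : Set ℂ} (hO : IsClosed O)
    (hA : IsClosed A) {lo hi : ℝ} (hle : lo ≤ hi) (hcov : ∀ u ∈ Icc lo hi, γ u ∈ O ∪ A)
    (hlo : γ lo ∈ A) (hhi : γ hi ∉ A) :
    ∃ t ∈ Ico lo hi, γ t ∈ A ∧ (∀ u ∈ Icc t hi, γ u ∈ O) ∧ ∀ u ∈ Ioc t hi, γ u ∉ A := by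
  set T : Set ℝ := Icc lo hi ∩ γ ⁻¹' A with hT
  have hTc : IsClosed T := isClosed_Icc.inter (hA.preimage hγ)
  have hTne : T.Nonempty := ⟨lo, left_mem_Icc.2 hle, hlo⟩
  have hTbdd : BddAbove T := ⟨hi, fun u hu => hu.1.2⟩
  set t := sSup T with ht
  have htT : t ∈ T := hTc.csSup_mem hTne hTbdd
  have hlt : t < hi := (eq_or_lt_of_le htT.1.2).resolve_left fun h => hhi (h ▸ htT.2 : γ hi ∈ A)
  have havoid : ∀ u ∈ Ioc t hi, γ u ∉ A := fun u hu h =>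
    absurd (le_csSup hTbdd ⟨⟨htT.1.1.trans hu.1.le, hu.2⟩, h⟩) (not_le.2 hu.1)
  have hafter : ∀ u ∈ Ioc t hi, γ u ∈ O := fun u hu =>
    (hcov u ⟨htT.1.1.trans hu.1.le, hu.2⟩).resolve_right (havoid u hu)
  have htO : γ t ∈ O := by
    have hmem : t ∈ closure (Ioc t hi) := by
      rw [closure_Ioc hlt.ne]; exact left_mem_Icc.2 hlt.le
    have himg : γ t ∈ closure (γ '' Ioc t hi) := hγ.continuousWithinAt.mem_closure_image hmem
    exact hO.closure_subset_iff.2 (Set.image_subset_iff.2 fun x hx => hafter x hx) himg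
  refine ⟨t, ⟨htT.1.1, hlt⟩, htT.2, fun u hu => ?_, havoid⟩
  rcases eq_or_lt_of_le hu.1 with h | htu
  · rw [← h]; exact htO
  · exact hafter u ⟨htu, hu.2⟩

/-! ## Trimming dangling edges -/

/-- **Trimming a dangling edge.**  If the preconnected `K` lies in the drawing of `τ` and misses
the drawn end `δx` of the lattice edge `{x, y}`, then the part of `K` inside the drawing of
`τ ∖ {{x, y}}` is preconnected: the drawings of `τ ∖ {{x, y}}` and of `{x, y}` meet inside `K`
at most at the single point `δy` (`exists_vertex_of_mem_inter`), and two closed pieces of a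
preconnected set glued along a preconnected patch stay preconnected
(`isPreconnected_inter_union_patch`). -/
theorem trim_edge (hδ : 0 < δ) {K : Set ℂ} (hK : IsPreconnected K) {τ : BondConfig (Site 2)}
    (hKτ : K ⊆ openEdgeUnion δ τ) {x y : Site 2} (hxy : (zdGraph 2).Adj x y)
    (hx : meshPoint δ x ∉ K) : IsPreconnected (K ∩ openEdgeUnion δ (τ \ {s(x, y)})) := by
  set O' := openEdgeUnion δ (τ \ {s(x, y)}) with hO'
  set DR := segment ℝ (meshPoint δ x) (meshPoint δ y) with hDR
  have hO'c : IsClosed O' := isClosed_openEdgeUnion hδ _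
  have hDRc : IsClosed DR := (isCompact_segment_complex _ _).isClosed
  have hKsub : K ⊆ O' ∪ DR := by
    refine hKτ.trans ((openEdgeUnion_subset_union_of_subset δ (R := {s(x, y)})
      (ω' := τ \ {s(x, y)}) fun e he => ?_).trans
      (Set.union_subset_union_right _ (openEdgeUnion_singleton_subset δ x y)))
    by_cases h : e = s(x, y)
    exacts [Or.inr h, Or.inl ⟨he, h⟩]
  have key : ∀ w ∈ K ∩ O' ∩ DR, w = meshPoint δ y := fun w ⟨⟨hwK, hwO⟩, hwD⟩ => by
    have hwS : w ∈ openEdgeUnion δ {s(x, y)} := mem_openEdgeUnion_iff.2 ⟨x, y, hxy, rfl, hwD⟩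
    obtain ⟨v, hv, ⟨y₁, -, hvy⟩, -⟩ := exists_vertex_of_mem_inter hδ (S := {s(x, y)})
      (T := τ \ {s(x, y)}) (fun e he hT => hT.2 he) hwS hwO
    rcases eq_or_eq_of_sym2_eq (Set.mem_singleton_iff.1 hvy) with rfl | rfl
    · exact absurd (hv ▸ hwK) hx
    · exact hv
  have hsub : (K ∩ O' ∩ DR).Subsingleton := fun z hz z' hz' => by rw [key z hz, key z' hz']
  by_cases hKDR : (K ∩ DR).Nonempty
  · have h := isPreconnected_inter_union_patch hK hKsub hO'c hDRc hsub.isPreconnected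
      Set.Subset.rfl hKDR
    rwa [Set.union_eq_left.2 (fun z hz => hz.1)] at h
  · rw [Set.not_nonempty_iff_eq_empty] at hKDR
    have hKO : K ⊆ O' := fun z hz => (hKsub hz).resolve_right fun h =>
      (Set.eq_empty_iff_forall_notMem.1 hKDR z) ⟨hz, h⟩
    rwa [Set.inter_eq_left.2 hKO]

/-- **Trimming a list of dangling edges.**  If the preconnected `K` lies in the drawing of `τ`
and misses the drawn first end of every selected pair of the list `L` (those satisfying `P`;
each a lattice edge), then the part of `K` inside the drawing of `τ` minus the selected edges is
preconnected (induction on `L`, `trim_edge`). -/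
theorem trim_list (hδ : 0 < δ) {K : Set ℂ} (hK : IsPreconnected K) (P : Site 2 × Site 2 → Prop) :
    ∀ (L : List (Site 2 × Site 2)) (τ τ' : BondConfig (Site 2)),
      (∀ xy ∈ L, P xy → (zdGraph 2).Adj xy.1 xy.2 ∧ meshPoint δ xy.1 ∉ K) →
      K ⊆ openEdgeUnion δ τ →
      (∀ ε, ε ∈ τ' ↔ ε ∈ τ ∧ ∀ xy ∈ L, P xy → ε ≠ s(xy.1, xy.2)) →
      IsPreconnected (K ∩ openEdgeUnion δ τ') := by
  classical
  intro L
  induction L with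
  | nil =>
    intro τ τ' _ hKτ hτ'
    have : τ' = τ := Set.ext fun ε => by simp [hτ' ε]
    rw [this, Set.inter_eq_left.2 hKτ]
    exact hK
  | cons xy L ih =>
    intro τ τ' hL hKτ hτ'
    set τ₁ : BondConfig (Site 2) := {ε | ε ∈ τ ∧ ∀ xy' ∈ L, P xy' → ε ≠ s(xy'.1, xy'.2)} with hτ₁
    have h₁ := ih τ τ₁ (fun xy' h => hL xy' (List.mem_cons_of_mem _ h)) hKτ (fun ε => Iff.rfl)
    have hK₁ : K ∩ openEdgeUnion δ τ₁ ⊆ openEdgeUnion δ τ₁ := Set.inter_subset_right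
    by_cases hP : P xy
    · have hxy := hL xy List.mem_cons_self hP
      have h₂ := trim_edge hδ h₁ hK₁ hxy.1 (fun h => hxy.2 h.1)
      have hτ'eq : τ' = τ₁ \ {s(xy.1, xy.2)} := Set.ext fun ε => by
        rw [hτ']
        simp only [List.forall_mem_cons, Set.mem_sdiff, Set.mem_setOf_eq, Set.mem_singleton_iff, hτ₁]
        constructor
        · rintro ⟨hε, h1, h2⟩; exact ⟨⟨hε, h2⟩, h1 hP⟩
        · rintro ⟨⟨hε, h2⟩, h1⟩; exact ⟨hε, fun _ => h1, h2⟩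
      have hmono : openEdgeUnion δ (τ₁ \ {s(xy.1, xy.2)}) ⊆ openEdgeUnion δ τ₁ :=
        openEdgeUnion_mono δ Set.sdiff_subset
      rw [hτ'eq]
      rwa [Set.inter_assoc, Set.inter_eq_right.2 hmono] at h₂
    · have hτ'eq : τ' = τ₁ := Set.ext fun ε => by
        rw [hτ']
        simp only [List.forall_mem_cons, Set.mem_setOf_eq, hτ₁]
        constructor
        · rintro ⟨hε, -, h2⟩; exact ⟨hε, h2⟩
        · rintro ⟨hε, h2⟩; exact ⟨hε, fun h => absurd h hP, h2⟩
      rw [hτ'eq]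
      exact h₁

/-! ## Lattice neighbours and the sixteen (corner, neighbour) pairs -/

/-- The four lattice neighbours of a point of `ℤ²`. -/
theorem zd2_adj_cases {x y : Site 2} (h : (zdGraph 2).Adj x y) :
    y = x + ![1, 0] ∨ y = x + ![-1, 0] ∨ y = x + ![0, 1] ∨ y = x + ![0, -1] := by
  rw [zdGraph_two_adj_iff] at h
  simp only [Site.eq_iff_two, Pi.add_apply, Matrix.cons_val_zero, Matrix.cons_val_one]
  omega

/-- Unit steps of `ℤ²` are lattice edges. -/
theorem zd2_adj_add_of_mem {x n : Site 2} (hn : n = ![1, 0] ∨ n = ![-1, 0] ∨ n = ![0, 1] ∨ n = ![0, -1]) :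
    (zdGraph 2).Adj x (x + n) := by
  rw [zdGraph_two_adj_iff]
  rcases hn with rfl | rfl | rfl | rfl <;> simp

/-- **Trimmed link.**  Let `C = {p, q, p', q'}` and let the arc `γ` on `[lo, hi]` run inside `[Q]`
and inside the drawing of `ρ` minus the cell edges (lattice edges with both ends in `C`), meeting
the drawn corners only at `δc`; let `z`, `w` be points of the arc, each on `∂₀Q ∪ ∂₂Q` or equal
to `δc`, and let every lattice edge at a corner be drawn off `∂₀Q ∪ ∂₂Q`.  Then `z` is joined to
`w` inside `[Q]` and inside the drawing of `ρ` minus every lattice edge at a corner which is a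
cell edge or sits at a corner other than `c` (trim the sixteen (corner, neighbour) pairs not based
at `c`, `trim_list`; the two marked points survive). -/
theorem trimmed_link (hδ : 0 < δ) (Q : Quad D) {p q p' q' c : Site 2} {C : Set (Site 2)}
    (hC : ∀ x, x ∈ C ↔ x = p ∨ x = q ∨ x = p' ∨ x = q') (hc : c ∈ C) {ρ : BondConfig (Site 2)}
    {γ : ℝ → ℂ} (hγ : Continuous γ) {lo hi : ℝ}
    (hQ : ∀ u ∈ Icc lo hi, γ u ∈ Q.carrier)
    (hO : ∀ u ∈ Icc lo hi, γ u ∈ openEdgeUnion δ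
      (ρ \ {ε | ∃ x y, ε = s(x, y) ∧ x ∈ C ∧ y ∈ C ∧ (zdGraph 2).Adj x y}))
    (havoid : ∀ u ∈ Icc lo hi, ∀ x ∈ C, γ u = meshPoint δ x → x = c)
    {z w : ℂ} (hz : z ∈ Q.side 0 ∪ Q.side 2 ∨ z = meshPoint δ c) (hzγ : z ∈ γ '' Icc lo hi)
    (hw : w ∈ Q.side 0 ∪ Q.side 2 ∨ w = meshPoint δ c) (hwγ : w ∈ γ '' Icc lo hi)
    (h02 : ∀ x ∈ C, ∀ y, (zdGraph 2).Adj x y →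
      Disjoint (segment ℝ (meshPoint δ x) (meshPoint δ y)) (Q.side 0 ∪ Q.side 2)) :
    JoinedIn (Q.carrier ∩ openEdgeUnion δ
      (ρ \ {ε | ∃ x y, ε = s(x, y) ∧ x ∈ C ∧ (zdGraph 2).Adj x y ∧ (y ∈ C ∨ x ≠ c)})) z w := by
  classical
  set C4 : Set (Sym2 (Site 2)) := {ε | ∃ x y, ε = s(x, y) ∧ x ∈ C ∧ y ∈ C ∧ (zdGraph 2).Adj x y}
    with hC4
  set Rc : Set (Sym2 (Site 2)) :=
    {ε | ∃ x y, ε = s(x, y) ∧ x ∈ C ∧ (zdGraph 2).Adj x y ∧ (y ∈ C ∨ x ≠ c)} with hRc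
  set K : Set ℂ := γ '' Icc lo hi with hKdef
  have hKc : IsCompact K := isCompact_Icc.image hγ
  have hKpc : IsPreconnected K := isPreconnected_Icc.image γ hγ.continuousOn
  have hKQ : K ⊆ Q.carrier := by rintro _ ⟨u, hu, rfl⟩; exact hQ u hu
  have hKO : K ⊆ openEdgeUnion δ (ρ \ C4) := by rintro _ ⟨u, hu, rfl⟩; exact hO u hu
  have hKρ : K ⊆ openEdgeUnion δ ρ := hKO.trans (openEdgeUnion_mono δ Set.sdiff_subset)
  have hcK : ∀ x ∈ C, x ≠ c → meshPoint δ x ∉ K := by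
    rintro x hx hxc ⟨u, hu, hux⟩
    exact hxc (havoid u hu x hx hux)
  -- the sixteen (corner, neighbour) pairs
  set N : List (Site 2) := [![1, 0], ![-1, 0], ![0, 1], ![0, -1]] with hN
  set L : List (Site 2 × Site 2) :=
    ([p, q, p', q'].flatMap fun x => N.map fun n => (x, x + n)) with hL
  have hLmem : ∀ xy ∈ L, xy.1 ∈ C ∧ (zdGraph 2).Adj xy.1 xy.2 := by
    intro xy hxy
    simp only [hL, hN, List.mem_flatMap, List.mem_map, List.mem_cons, List.not_mem_nil,
      or_false] at hxy
    obtain ⟨x, hx, n, hn, rfl⟩ := hxy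
    exact ⟨(hC x).2 hx, zd2_adj_add_of_mem hn⟩
  have hLenum : ∀ x ∈ C, ∀ y, (zdGraph 2).Adj x y → (x, y) ∈ L := by
    intro x hx y hxy
    simp only [hL, hN, List.mem_flatMap, List.mem_map, List.mem_cons, List.not_mem_nil, or_false]
    refine ⟨x, (hC x).1 hx, y - x, ?_, by simp⟩
    rcases zd2_adj_cases hxy with h | h | h | h <;> simp [h]
  -- trim
  have hpre : IsPreconnected (K ∩ openEdgeUnion δ (ρ \ Rc)) := by
    refine trim_list hδ hKpc (fun xy => xy.1 ≠ c) L ρ (ρ \ Rc)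
      (fun xy hxy hP => ⟨(hLmem xy hxy).2, hcK _ (hLmem xy hxy).1 hP⟩) hKρ (fun ε => ?_)
    simp only [Set.mem_sdiff, hRc, Set.mem_setOf_eq, not_exists, not_and, ne_eq]
    refine and_congr_right fun _ => ⟨fun h xy hxy hP heq => ?_, fun h x y heq hx hxy hor => ?_⟩
    · exact h xy.1 xy.2 heq (hLmem xy hxy).1 (hLmem xy hxy).2 (Or.inr hP)
    · rcases hor with hy | hxc
      · by_cases hxc : x = c
        · refine h (y, x) (hLenum y hy x hxy.symm) ?_ (by rw [heq, Sym2.eq_swap])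
          rw [← hxc]; exact hxy.ne.symm
        · exact h (x, y) (hLenum x hx y hxy) hxc heq
      · exact h (x, y) (hLenum x hx y hxy) hxc heq
  -- the marked points survive the trimming
  have hsurv : ∀ z ∈ K, (z ∈ Q.side 0 ∪ Q.side 2 ∨ z = meshPoint δ c) →
      z ∈ K ∩ openEdgeUnion δ (ρ \ Rc) := fun z hzK hz => by
    refine ⟨hzK, ?_⟩
    obtain ⟨x', y', hxy', hε, hzs⟩ := mem_openEdgeUnion_iff.1 (hKO hzK)
    refine mem_openEdgeUnion_iff.2 ⟨x', y', hxy', ⟨hε.1, ?_⟩, hzs⟩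
    rintro ⟨x, y, heq, hx, hxy, hor⟩
    rw [segment_meshPoint_eq_of_sym2_eq δ heq] at hzs
    rcases hz with hz | rfl
    · exact Set.disjoint_left.1 (h02 x hx y hxy) hzs hz
    have hyC : y ∉ C := fun hy => hε.2 ⟨x, y, heq, hx, hy, hxy⟩
    rcases Mesh.eq_or_eq_of_meshPoint_mem_segment hδ hxy hzs with rfl | rfl
    · exact (hor.resolve_left hyC) rfl
    · exact hyC hc
  exact joinedIn_inter_openEdgeUnion_of_isConnected hδ (hKc.inter_right (isClosed_openEdgeUnion hδ _))
    ⟨⟨z, hsurv z hzγ hz⟩, hpre⟩ Set.inter_subset_right (Set.inter_subset_left.trans hKQ)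
    (hsurv z hzγ hz) (hsurv w hwγ hw)

/-! ## Entry and exit corners of a crossing through a free cell -/

/-- **Entry and exit corners** (registered helper).  Let `C = {p, q, p', q'}` with `p ∼ q`,
`p' ∼ q'` lattice edges, let every lattice edge at a corner be drawn off `∂₀Q ∪ ∂₂Q`, and let
`Q` be crossed inside the drawing of `ρ` (path form) but not inside that of `ρ ∖ {{p, q}}`.  Cut
the crossing path at its first and last visits to the drawn cell boundary (the drawing of the
cell edges): both cuts are drawn corners `c_in`, `c_out` (a point common to the drawings of two
edge-disjoint configurations is a drawn lattice end of both), `c_in ≠ c_out`; the initial arc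
links `∂₀Q` to `δc_in` and avoids the other corners, so it survives the trimming of every lattice
edge at a corner other than `c_in` and of the cell edges (`trimmed_link`), and symmetrically for
`c_out` and `∂₂Q`; finally, inside the drawing of `ρ ∖ {{p, q}}`, `c_in` is not linked to `∂₂Q`,
`c_out` not to `∂₀Q`, and the two are not joined (each would complete a crossing). -/
theorem freeCell_entryExit : ∀ {D : Set ℂ} {δ : ℝ}, 0 < δ → ∀ (Q : Quad D) (p q p' q' : Site 2) (C : Set (Site 2)) (ρ : BondConfig (Site 2)), (∀ x, x ∈ C ↔ x = p ∨ x = q ∨ x = p' ∨ x = q') → (zdGraph 2).Adj p q → (zdGraph 2).Adj p' q' → (∃ a ∈ Q.side 0, ∃ b ∈ Q.side 2, JoinedIn (Q.carrier ∩ openEdgeUnion δ ρ) a b) → (¬ ∃ a ∈ Q.side 0, ∃ b ∈ Q.side 2, JoinedIn (Q.carrier ∩ openEdgeUnion δ (ρ \ {s(p, q)})) a b) → (∀ x ∈ C, ∀ y, (zdGraph 2).Adj x y → Disjoint (segment ℝ (meshPoint δ x) (meshPoint δ y)) (Q.side 0 ∪ Q.side 2)) → ∃ cin ∈ C, ∃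 cout ∈ C, cin ≠ cout ∧ (∃ a ∈ Q.side 0, JoinedIn (Q.carrier ∩ openEdgeUnion δ (ρ \ {ε | ∃ x y, ε = s(x, y) ∧ x ∈ C ∧ (zdGraph 2).Adj x y ∧ (y ∈ C ∨ x ≠ cin)})) a (meshPoint δ cin)) ∧ (∃ b ∈ Q.side 2, JoinedIn (Q.carrier ∩ openEdgeUnion δ (ρ \ {ε | ∃ x y, ε = s(x, y) ∧ x ∈ C ∧ (zdGraph 2).Adj x y ∧ (y ∈ C ∨ x ≠ cout)})) b (meshPoint δ cout)) ∧ (¬ ∃ b ∈ Q.side 2, JoinedIn (Q.carrier ∩ openEdgeUnion δ (ρ \ {s(p, q)})) b (meshPoint δ cin)) ∧ (¬ ∃ a ∈ Q.side 0, JoinedIn (Q.carrier ∩ openEdgeUnion δ (ρ \ {s(p, q)})) a (meshPoint δ cout)) ∧ ¬ JoinedIn (Q.carrier ∩ openEdgeUnion δ (ρ \ {s(p, q)})) (meshPoint δ cin) (meshPoint δ cout) := by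
  intro D δ hδ Q p q p' q' C ρ hC hpq hp'q' hcr hσ h02
  classical
  obtain ⟨a, ha, b, hb, hJ⟩ := hcr
  set C4 : Set (Sym2 (Site 2)) := {ε | ∃ x y, ε = s(x, y) ∧ x ∈ C ∧ y ∈ C ∧ (zdGraph 2).Adj x y}
    with hC4
  have hpC : p ∈ C := (hC p).2 (Or.inl rfl)
  have hqC : q ∈ C := (hC q).2 (Or.inr (Or.inl rfl))
  have hp'C : p' ∈ C := (hC p').2 (Or.inr (Or.inr (Or.inl rfl)))
  have hq'C : q' ∈ C := (hC q').2 (Or.inr (Or.inr (Or.inr rfl)))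
  have heC4 : s(p, q) ∈ C4 := ⟨p, q, rfl, hpC, hqC, hpq⟩
  have hsubσ : ρ \ C4 ⊆ ρ \ {s(p, q)} := Set.sdiff_subset_sdiff_right (Set.singleton_subset_iff.2 heC4)
  set πa := hJ.somePath with hπa
  set γ : ℝ → ℂ := ⇑πa.extend with hγdef
  have hγc : Continuous γ := πa.continuous_extend
  set O := openEdgeUnion δ (ρ \ C4) with hOdef
  set A := openEdgeUnion δ C4 with hAdef
  have hOc : IsClosed O := isClosed_openEdgeUnion hδ _
  have hAc : IsClosed A := isClosed_openEdgeUnion hδ _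
  have hγmem : ∀ u, γ u ∈ Q.carrier ∧ γ u ∈ O ∪ A := fun u => by
    have h1 : γ u ∈ Set.range πa := by rw [← πa.extend_range]; exact ⟨u, rfl⟩
    obtain ⟨s, hs⟩ := h1
    have h2 := hJ.somePath_mem s
    rw [← hπa, hs] at h2
    refine ⟨h2.1, openEdgeUnion_subset_union_of_subset δ (fun ε hε => ?_) h2.2⟩
    by_cases h : ε ∈ C4
    exacts [Or.inr h, Or.inl ⟨hε, h⟩]
  have hγ0 : γ 0 = a := πa.extend_zero
  have hγ1 : γ 1 = b := πa.extend_one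
  -- the drawn cell boundary misses `∂₀Q ∪ ∂₂Q` and contains the drawn corners
  have hA02 : ∀ z ∈ A, z ∉ Q.side 0 ∪ Q.side 2 := fun z hz hz' => by
    obtain ⟨x, y, hxy, ⟨x₁, y₁, heq, hx₁, -, hxy₁⟩, hzs⟩ := mem_openEdgeUnion_iff.1 hz
    rw [segment_meshPoint_eq_of_sym2_eq δ heq] at hzs
    exact Set.disjoint_left.1 (h02 x₁ hx₁ y₁ hxy₁) hzs hz'
  have hCA : ∀ x ∈ C, meshPoint δ x ∈ A := fun x hx => by
    rcases (hC x).1 hx with rfl | rfl | rfl | rfl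
    · exact mem_openEdgeUnion_iff.2 ⟨_, q, hpq, heC4, left_mem_segment ℝ _ _⟩
    · exact mem_openEdgeUnion_iff.2 ⟨p, _, hpq, heC4, right_mem_segment ℝ _ _⟩
    · exact mem_openEdgeUnion_iff.2 ⟨_, q', hp'q', ⟨_, q', rfl, hp'C, hq'C, hp'q'⟩, left_mem_segment ℝ _ _⟩
    · exact mem_openEdgeUnion_iff.2 ⟨p', _, hp'q', ⟨p', _, rfl, hp'C, hq'C, hp'q'⟩, right_mem_segment ℝ _ _⟩
  -- a point of `O ∩ A` is a drawn corner
  have hvertex : ∀ z ∈ A, z ∈ O → ∃ x ∈ C, z = meshPoint δ x := fun z hzA hzO => by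
    obtain ⟨v, hv, ⟨y, -, ⟨x₁, y₁, heq, hx₁, hy₁, -⟩⟩, -⟩ :=
      exists_vertex_of_mem_inter hδ (S := C4) (T := ρ \ C4) (fun e he hT => hT.2 he) hzA hzO
    rcases eq_or_eq_of_sym2_eq heq with rfl | rfl
    exacts [⟨_, hx₁, hv⟩, ⟨_, hy₁, hv⟩]
  have ha' : γ 0 ∉ A := fun h => hA02 _ h (Or.inl (hγ0 ▸ ha))
  have hb' : γ 1 ∉ A := fun h => hA02 _ h (Or.inr (hγ1 ▸ hb))
  -- the path meets the cell boundary
  have hhit : ∃ u ∈ Icc (0 : ℝ) 1, γ u ∈ A := by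
    by_contra hno
    push Not at hno
    refine hσ ⟨a, ha, b, hb, ?_⟩
    have := joinedIn_of_arc (F := Q.carrier ∩ openEdgeUnion δ (ρ \ {s(p, q)})) hγc zero_le_one
      (fun u hu => ⟨(hγmem u).1, openEdgeUnion_mono δ hsubσ
        (((hγmem u).2.resolve_right (hno u hu)))⟩)
    rwa [hγ0, hγ1] at this
  obtain ⟨w, hw, hγw⟩ := hhit
  -- first and last visits
  obtain ⟨s₀, hs₀, hγs₀, hO₀, hav₀⟩ :=
    exists_first_hit_avoid hγc hOc hAc hw.1 (fun u _ => (hγmem u).2) ha' hγw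
  have hs₀1 : s₀ ≤ 1 := hs₀.2.trans hw.2
  obtain ⟨u₀, hu₀, hγu₀, hO₁, hav₁⟩ :=
    exists_last_hit_avoid hγc hOc hAc hs₀1 (fun u _ => (hγmem u).2) hγs₀ hb'
  obtain ⟨cin, hcin, hγcin⟩ := hvertex _ hγs₀ (hO₀ s₀ (right_mem_Icc.2 hs₀.1.le))
  obtain ⟨cout, hcout, hγcout⟩ := hvertex _ hγu₀ (hO₁ u₀ (left_mem_Icc.2 hu₀.2.le))
  -- untrimmed links
  have hJin : JoinedIn (Q.carrier ∩ openEdgeUnion δ (ρ \ {s(p, q)})) a (meshPoint δ cin) := by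
    have := joinedIn_of_arc (F := Q.carrier ∩ openEdgeUnion δ (ρ \ {s(p, q)})) hγc hs₀.1.le
      (fun u hu => ⟨(hγmem u).1, openEdgeUnion_mono δ hsubσ (hO₀ u hu)⟩)
    rwa [hγ0, hγcin] at this
  have hJout : JoinedIn (Q.carrier ∩ openEdgeUnion δ (ρ \ {s(p, q)})) (meshPoint δ cout) b := by
    have := joinedIn_of_arc (F := Q.carrier ∩ openEdgeUnion δ (ρ \ {s(p, q)})) hγc hu₀.2.le
      (fun u hu => ⟨(hγmem u).1, openEdgeUnion_mono δ hsubσ (hO₁ u hu)⟩)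
    rwa [hγ1, hγcout] at this
  have hn1 : ¬ ∃ b ∈ Q.side 2, JoinedIn (Q.carrier ∩ openEdgeUnion δ (ρ \ {s(p, q)})) b (meshPoint δ cin) :=
    fun ⟨b', hb', hJ'⟩ => hσ ⟨a, ha, b', hb', hJin.trans hJ'.symm⟩
  have hn2 : ¬ ∃ a ∈ Q.side 0, JoinedIn (Q.carrier ∩ openEdgeUnion δ (ρ \ {s(p, q)})) a (meshPoint δ cout) :=
    fun ⟨a', ha', hJ'⟩ => hσ ⟨a', ha', b, hb, hJ'.trans hJout⟩
  have hn12 : ¬ JoinedIn (Q.carrier ∩ openEdgeUnion δ (ρ \ {s(p, q)})) (meshPoint δ cin) (meshPoint δ cout) :=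
    fun hJ' => hσ ⟨a, ha, b, hb, (hJin.trans hJ').trans hJout⟩
  have hne : cin ≠ cout := fun h => hn12 (by rw [h]; exact JoinedIn.refl hJout.source_mem)
  -- injectivity of the drawing on the corners
  have hinj : ∀ x y : Site 2, meshPoint δ x = meshPoint δ y → x = y := fun x y h => by
    have h0 := congrArg Complex.re h
    have h1 := congrArg Complex.im h
    simp only [meshPoint_re, meshPoint_im, mul_eq_mul_left_iff, hδ.ne', or_false, Int.cast_inj] at h0 h1
    exact Site.eq_iff_two.2 ⟨h0, h1⟩
  -- trimmed links
  have hLin := trimmed_link hδ Q hC hcin hγc (lo := 0) (hi := s₀) (fun u hu => (hγmem u).1) hO₀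
    (fun u hu x hx hux => by
      rcases eq_or_lt_of_le hu.2 with h | h
      · exact hinj _ _ (by rw [← hux, h, hγcin])
      · exact absurd (hux ▸ hCA x hx) (hav₀ u ⟨hu.1, h⟩))
    (Or.inl (Or.inl ha)) ⟨0, left_mem_Icc.2 hs₀.1.le, hγ0⟩ (Or.inr rfl)
    ⟨s₀, right_mem_Icc.2 hs₀.1.le, hγcin⟩ h02
  have hLout := trimmed_link hδ Q hC hcout hγc (lo := u₀) (hi := 1) (fun u hu => (hγmem u).1) hO₁
    (fun u hu x hx hux => by
      rcases eq_or_lt_of_le hu.1 with h | h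
      · exact hinj _ _ (by rw [← hux, ← h, hγcout])
      · exact absurd (hux ▸ hCA x hx) (hav₁ u ⟨h, hu.2⟩))
    (Or.inl (Or.inr hb)) ⟨1, right_mem_Icc.2 hu₀.2.le, hγ1⟩ (Or.inr rfl)
    ⟨u₀, left_mem_Icc.2 hu₀.2.le, hγcout⟩ h02
  exact ⟨cin, hcin, cout, hcout, hne, ⟨a, ha, hLin⟩, ⟨b, hb, hLout⟩, hn1, hn2, hn12⟩

end Summit.CriticalPhenomena.CardyFormulaZ2.Theorems.CardySelfRefinement

end
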